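import Summits.CriticalPhenomena.PercolationContinuityZ3.Theorems.PercNearOneGluingNoHeavyLowerTailHubPairApexFold
import HarnessLib

/-!
# `NoHeavyLowerTail` (stmt-CriticalPhenomena-4575) — HUB PAIRS WITH THE APEX ALONE ON ITS SIDE, part 6:
# the gadget arm `{ah₁, ah₂}` realises every ratio `(∑ η : BondConfig V, rcWeightW wA q ({h₁, h₂} : Set V) η * ind {η : BondConfig V | h₁ ∈ cl η.toFinset a ∧ h₂ ∈ cl η.toFinset a} η) : (∑ η : BondConfig V, rcWeightW wA q ({h₁, h₂} : Set V) η * ind {η : BondConfig V | h₁ ∈ cl η.toFinset a ∧ h₂ ∉ cl η.toFinset a} η) : (∑ η : BondConfig V, rcWeightW wA q ({h₁, h₂} : Set V) η * ind {η : BondConfig V | h₁ ∉ cl η.toFinset a ∧ h₂ ∈ cl η.toFinset a} η)` — apex arms FOLD to a path `h₁ – a – h₂`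

Support file (prover prim-gen-kcluster gen 72; `--supports stmt-CriticalPhenomena-4575`).  No definitions, no named facts, no sorries.
Notation of parts 1–5.  `gadget_masses`: for a weight vector `u` supported on the two pairs `ah₁, ah₂` with values `p₁, p₂`, the `{h₁,h₂}`-wired
masses of the states `A, C, D` are `κ·p₁p₂`, `κ·p₁(1−p₂)`, `κ·(1−p₁)p₂` (`κ = q^{k^T}` of the connected gadget configurations).
**THEOREM** (`HubPairApex.r1_iff_gadget`): let the apex arm `DA ∋ a` be glued to the rest `DY ∋ b, c` at `{h₁,h₂}` (hypotheses of part 3), with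
wired state masses `(∑ η : BondConfig V, rcWeightW wA q ({h₁, h₂} : Set V) η * ind {η : BondConfig V | h₁ ∈ cl η.toFinset a ∧ h₂ ∈ cl η.toFinset a} η) ≠ 0, (∑ η : BondConfig V, rcWeightW wA q ({h₁, h₂} : Set V) η * ind {η : BondConfig V | h₁ ∈ cl η.toFinset a ∧ h₂ ∉ cl η.toFinset a} η), (∑ η : BondConfig V, rcWeightW wA q ({h₁, h₂} : Set V) η * ind {η : BondConfig V | h₁ ∉ cl η.toFinset a ∧ h₂ ∈ cl η.toFinset a} η)`; let `𝐩'` agree with the far-side weights off the gadget and give the pairs `ah₁, ah₂` parameters `p₁, p₂`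
with `p₁((∑ η : BondConfig V, rcWeightW wA q ({h₁, h₂} : Set V) η * ind {η : BondConfig V | h₁ ∈ cl η.toFinset a ∧ h₂ ∈ cl η.toFinset a} η) + (∑ η : BondConfig V, rcWeightW wA q ({h₁, h₂} : Set V) η * ind {η : BondConfig V | h₁ ∉ cl η.toFinset a ∧ h₂ ∈ cl η.toFinset a} η)) = (∑ η : BondConfig V, rcWeightW wA q ({h₁, h₂} : Set V) η * ind {η : BondConfig V | h₁ ∈ cl η.toFinset a ∧ h₂ ∈ cl η.toFinset a} η)`, `p₂((∑ η : BondConfig V, rcWeightW wA q ({h₁, h₂} : Set V) η * ind {η : BondConfig V | h₁ ∈ cl η.toFinset a ∧ h₂ ∈ cl η.toFinset a} η) + (∑ η : BondConfig V, rcWeightW wA q ({h₁, h₂} : Set V) η * ind {η : BondConfig V | h₁ ∈ cl η.toFinset a ∧ h₂ ∉ cl η.toFinset a} η)) = (∑ η : BondConfig V, rcWeightW wA q ({h₁, h₂} : Set V) η * ind {η : BondConfig V | h₁ ∈ cl η.toFinset a ∧ h₂ ∈ cl η.toFinset a} η)`.  Then R1 for `(a; b, c)` holds for `φ_{𝐩,q}`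 on `DA ∪ DY` IFF it holds for `φ_{𝐩',q}` on
`{ah₁, ah₂} ∪ DY`.  Such `p₁, p₂ ∈ [0,1]` exist (`exists_gadget_weight`).  ⇒ in a minimal counterexample to R1-RC(q) every hub pair with the
apex alone on its side has the trivial apex side: THE APEX HAS DEGREE 2 there; and R1-RC for all graphs with an apex-isolating hub pair is
equivalent to R1-RC for graphs whose apex has degree 2 (every `q > 0`).
-/

noncomputable section

namespace Summit.CriticalPhenomena.PercolationContinuityZ3.Theorems

namespace HubPairApex

open Finset SimpleGraph Literature.Probability.Percolation Literature.Probability.Percolation.Gladkov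
open Literature.Probability.Percolation.BHK2006 (weight)
open Literature.Probability.Percolation.DecisionTree (ind ind_of_mem ind_of_not_mem ind_nonneg)
open Literature.Probability.LatticeModels RefinedRowR3 ThreePointLB APL MeasureTheory
open scoped Classical

variable {V : Type*} [Fintype V]

/-! ### The gadget arm `{ah₁, ah₂}` -/

section Gadget

variable {a h₁ h₂ : V} (h12 : h₁ ≠ h₂) (ha1 : a ≠ h₁) (ha2 : a ≠ h₂) (q : ℝ)
  (u : Sym2 V → unitInterval) (hu : ∀ e, e ≠ s(a, h₁) → e ≠ s(a, h₂) → u e = 0)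
include h12

omit [Fintype V] in
/-- The two gadget pairs are distinct. [folklore] -/
theorem gadget_ne : s(a, h₁) ≠ s(a, h₂) := fun h => by
  rcases Sym2.eq_iff.1 h with ⟨_, h'⟩ | ⟨h', h''⟩
  · exact h12 h'
  · exact h12 (h''.trans h')

include hu in
/-- A sum against a weight vector supported on the two gadget pairs has four terms. [folklore] -/
theorem gadget_sum (f : BondConfig V → ℝ) :
    ∑ η : BondConfig V, rcWeightW u q ({h₁, h₂} : Set V) η * f η =
      rcWeightW u q ({h₁, h₂} : Set V) ∅ * f ∅ + rcWeightW u q ({h₁, h₂} : Set V) {s(a, h₁)} * f {s(a, h₁)} + rcWeightW u q ({h₁, h₂} : Set V) {s(a, h₂)} * f {s(a, h₂)} +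
        rcWeightW u q ({h₁, h₂} : Set V) {s(a, h₁), s(a, h₂)} * f {s(a, h₁), s(a, h₂)} := by
  have hne := gadget_ne (a := a) h12
  have hw0 : ∀ e, e ∉ ({s(a, h₁), s(a, h₂)} : Set (Sym2 V)) → (u e : ℝ) = 0 := fun e he => by
    rw [hu e (fun h => he (Or.inl h)) (fun h => he (Or.inr h))]; rfl
  have hvan : ∀ η : BondConfig V, η ≠ ∅ → η ≠ {s(a, h₁)} → η ≠ {s(a, h₂)} → η ≠ {s(a, h₁), s(a, h₂)} →
      rcWeightW u q ({h₁, h₂} : Set V) η * f η = 0 := by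
    intro η h0 h1 h2 h3
    obtain ⟨e, he, he'⟩ : ∃ e ∈ η, e ∉ ({s(a, h₁), s(a, h₂)} : Set (Sym2 V)) := by
      by_contra hcon
      push Not at hcon
      by_cases c1 : s(a, h₁) ∈ η <;> by_cases c2 : s(a, h₂) ∈ η
      · exact h3 (Set.Subset.antisymm (fun e he => hcon e he) (by
          intro e he; rcases he with rfl | rfl; exacts [c1, c2]))
      · exact h1 (Set.Subset.antisymm (fun e he => by
          rcases hcon e he with h | h
          · exact h
          · exact absurd (h ▸ he) c2) (by intro e he; rw [Set.mem_singleton_iff] at he; subst he; exact c1))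
      · exact h2 (Set.Subset.antisymm (fun e he => by
          rcases hcon e he with h | h
          · exact absurd (h ▸ he) c1
          · exact h) (by intro e he; rw [Set.mem_singleton_iff] at he; subst he; exact c2))
      · exact h0 (Set.eq_empty_of_forall_notMem fun e he => by
          rcases hcon e he with h | h
          · exact c1 (h ▸ he)
          · exact c2 (h ▸ he))
    have hz := ApexTwoSum.weight_eq_zero_of_mem_not_mem u hw0 he he'
    unfold rcWeightW
    rw [hz]; ring
  -- distinctness of the four configurations
  have d01 : (∅ : BondConfig V) ≠ {s(a, h₁)} := fun h => (Set.singleton_nonempty _).ne_empty h.symm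
  have d02 : (∅ : BondConfig V) ≠ {s(a, h₂)} := fun h => (Set.singleton_nonempty _).ne_empty h.symm
  have d03 : (∅ : BondConfig V) ≠ {s(a, h₁), s(a, h₂)} := fun h => (Set.insert_nonempty _ _).ne_empty h.symm
  have d12 : ({s(a, h₁)} : BondConfig V) ≠ {s(a, h₂)} := fun h => hne (Set.singleton_eq_singleton_iff.1 h)
  have d13 : ({s(a, h₁)} : BondConfig V) ≠ {s(a, h₁), s(a, h₂)} := fun h => by
    have h' : s(a, h₂) ∈ ({s(a, h₁)} : Set (Sym2 V)) := by rw [h]; exact Or.inr rfl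
    exact hne (Set.mem_singleton_iff.1 h').symm
  have d23 : ({s(a, h₂)} : BondConfig V) ≠ {s(a, h₁), s(a, h₂)} := fun h => by
    have h' : s(a, h₁) ∈ ({s(a, h₂)} : Set (Sym2 V)) := by rw [h]; exact Or.inl rfl
    exact hne (Set.mem_singleton_iff.1 h')
  rw [← Finset.sum_subset (Finset.subset_univ ({∅, {s(a, h₁)}, {s(a, h₂)}, {s(a, h₁), s(a, h₂)}} : Finset (BondConfig V)))
      (fun η _ hη => by
        simp only [Finset.mem_insert, Finset.mem_singleton, not_or] at hη
        exact hvan η hη.1 hη.2.1 hη.2.2.1 hη.2.2.2)]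
  rw [Finset.sum_insert (by simp only [Finset.mem_insert, Finset.mem_singleton, not_or]; exact ⟨d01, d02, d03⟩),
    Finset.sum_insert (by simp only [Finset.mem_insert, Finset.mem_singleton, not_or]; exact ⟨d12, d13⟩),
    Finset.sum_pair d23]
  ring

include hu in
/-- The product weight of a gadget configuration. [folklore] -/
theorem gadget_weight_pair : weight (fun e => (u e : ℝ)) ({s(a, h₁), s(a, h₂)} : BondConfig V) = (u s(a, h₁) : ℝ) * u s(a, h₂) := by
  have hne := gadget_ne (a := a) h12
  unfold weight
  rw [Finset.prod_eq_mul s(a, h₁) s(a, h₂) hne ?_ (fun h => absurd (Finset.mem_univ _) h) (fun h => absurd (Finset.mem_univ _) h)]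
  · simp only [Set.mem_insert_iff, Set.mem_singleton_iff, true_or, or_true, if_true]
  · intro e _ hne'
    have h1 : e ∉ ({s(a, h₁), s(a, h₂)} : Set (Sym2 V)) := fun h => h.elim hne'.1 hne'.2
    simp only [h1, if_false, hu e hne'.1 hne'.2, Set.Icc.coe_zero, sub_zero]

include hu in
/-- The product weight of a gadget configuration. [folklore] -/
theorem gadget_weight_one : weight (fun e => (u e : ℝ)) ({s(a, h₁)} : BondConfig V) = (u s(a, h₁) : ℝ) * (1 - u s(a, h₂)) := by
  have hne := gadget_ne (a := a) h12
  unfold weight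
  rw [Finset.prod_eq_mul s(a, h₁) s(a, h₂) hne ?_ (fun h => absurd (Finset.mem_univ _) h) (fun h => absurd (Finset.mem_univ _) h)]
  · have h2 : s(a, h₂) ∉ ({s(a, h₁)} : Set (Sym2 V)) := fun h => hne (Set.mem_singleton_iff.1 h).symm
    simp only [Set.mem_singleton_iff, if_true, h2, if_false]
  · intro e _ hne'
    have h1 : e ∉ ({s(a, h₁)} : Set (Sym2 V)) := fun h => hne'.1 (Set.mem_singleton_iff.1 h)
    simp only [h1, if_false, hu e hne'.1 hne'.2, Set.Icc.coe_zero, sub_zero]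

include hu in
/-- The product weight of a gadget configuration. [folklore] -/
theorem gadget_weight_two : weight (fun e => (u e : ℝ)) ({s(a, h₂)} : BondConfig V) = (1 - u s(a, h₁) : ℝ) * u s(a, h₂) := by
  have hne := gadget_ne (a := a) h12
  unfold weight
  rw [Finset.prod_eq_mul s(a, h₁) s(a, h₂) hne ?_ (fun h => absurd (Finset.mem_univ _) h) (fun h => absurd (Finset.mem_univ _) h)]
  · have h1 : s(a, h₁) ∉ ({s(a, h₂)} : Set (Sym2 V)) := fun h => hne (Set.mem_singleton_iff.1 h)
    simp only [Set.mem_singleton_iff, if_true, h1, if_false]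
  · intro e _ hne'
    have h2 : e ∉ ({s(a, h₂)} : Set (Sym2 V)) := fun h => hne'.2 (Set.mem_singleton_iff.1 h)
    simp only [h2, if_false, hu e hne'.1 hne'.2, Set.Icc.coe_zero, sub_zero]

include ha1 ha2 in
/-- The three connected gadget configurations have the same `{h₁,h₂}`-wired count. [folklore] -/
theorem kT_gadget :
    clusterCount ({s(a, h₁)} : BondConfig V) ({h₁, h₂} : Set V) = clusterCount ({s(a, h₁), s(a, h₂)} : BondConfig V) ({h₁, h₂} : Set V) ∧
      clusterCount ({s(a, h₂)} : BondConfig V) ({h₁, h₂} : Set V) = clusterCount ({s(a, h₁), s(a, h₂)} : BondConfig V) ({h₁, h₂} : Set V) := by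
  have hw : ∀ x y : V, x ∈ ({h₁, h₂} : Set V) → y ∈ ({h₁, h₂} : Set V) → x ≠ y → ∀ H : SimpleGraph V, (H ⊔ wired ({h₁, h₂} : Set V)).Adj x y := fun x y hx hy hxy H => by
    rw [sup_adj, wired_adj]; exact Or.inr ⟨hxy, hx, hy⟩
  constructor
  · have e1 : ({s(a, h₁), s(a, h₂)} : BondConfig V) = insert s(a, h₂) {s(a, h₁)} := Set.pair_comm _ _
    unfold clusterCount
    rw [e1, ThreeSum.openGraph_insert, sup_right_comm]
    refine (card_connectedComponent_sup_edge_of_reachable _ ?_).symm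
    have h1 : (openGraph ({s(a, h₁)} : BondConfig V) ⊔ wired ({h₁, h₂} : Set V)).Adj a h₁ := by
      rw [sup_adj, openGraph_adj]; exact Or.inl ⟨Set.mem_singleton _, ha1⟩
    exact h1.reachable.trans (hw h₁ h₂ (Set.mem_insert _ _) (Set.mem_insert_of_mem _ (Set.mem_singleton _)) h12 _).reachable
  · unfold clusterCount
    rw [show ({s(a, h₁), s(a, h₂)} : BondConfig V) = insert s(a, h₁) {s(a, h₂)} from rfl, ThreeSum.openGraph_insert, sup_right_comm]
    refine (card_connectedComponent_sup_edge_of_reachable _ ?_).symm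
    have h2 : (openGraph ({s(a, h₂)} : BondConfig V) ⊔ wired ({h₁, h₂} : Set V)).Adj a h₂ := by
      rw [sup_adj, openGraph_adj]; exact Or.inl ⟨Set.mem_singleton _, ha2⟩
    exact h2.reachable.trans (hw h₂ h₁ (Set.mem_insert_of_mem _ (Set.mem_singleton _)) (Set.mem_insert _ _) h12.symm _).reachable

include ha1 ha2 hu in
/-- **Wired masses of the gadget arm**: `(∑ η : BondConfig V, rcWeightW wA q ({h₁, h₂} : Set V) η * ind {η : BondConfig V | h₁ ∈ cl η.toFinset a ∧ h₂ ∈ cl η.toFinset a} η)' = p₁p₂κ`, `(∑ η : BondConfig V, rcWeightW wA q ({h₁, h₂} : Set V) η * ind {η : BondConfig V | h₁ ∈ cl η.toFinset a ∧ h₂ ∉ cl η.toFinset a} η)' = p₁(1−p₂)κ`, `(∑ η : BondConfig V, rcWeightW wA q ({h₁, h₂} : Set V) η * ind {η : BondConfig V | h₁ ∉ cl η.toFinset a ∧ h₂ ∈ cl η.toFinset a} η)' = (1−p₁)p₂κ`. [this work] -/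
theorem gadget_masses :
    (∑ η : BondConfig V, rcWeightW u q ({h₁, h₂} : Set V) η * ind {η : BondConfig V | h₁ ∈ cl η.toFinset a ∧ h₂ ∈ cl η.toFinset a} η) = (u s(a, h₁) : ℝ) * u s(a, h₂) * q ^ clusterCount ({s(a, h₁), s(a, h₂)} : BondConfig V) ({h₁, h₂} : Set V) ∧
    (∑ η : BondConfig V, rcWeightW u q ({h₁, h₂} : Set V) η * ind {η : BondConfig V | h₁ ∈ cl η.toFinset a ∧ h₂ ∉ cl η.toFinset a} η) = (u s(a, h₁) : ℝ) * (1 - u s(a, h₂)) * q ^ clusterCount ({s(a, h₁), s(a, h₂)} : BondConfig V) ({h₁, h₂} : Set V) ∧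
    (∑ η : BondConfig V, rcWeightW u q ({h₁, h₂} : Set V) η * ind {η : BondConfig V | h₁ ∉ cl η.toFinset a ∧ h₂ ∈ cl η.toFinset a} η) = (1 - u s(a, h₁) : ℝ) * u s(a, h₂) * q ^ clusterCount ({s(a, h₁), s(a, h₂)} : BondConfig V) ({h₁, h₂} : Set V) := by
  have bA := bits_A (V := V) ha1 ha2
  have bC := bits_C (V := V) h12 ha1 ha2
  have bD := bits_D (V := V) h12 ha1 ha2
  have bE := bits_E (V := V) (a := a) h12 ha1 ha2
  obtain ⟨k1, k2⟩ := kT_gadget (V := V) h12 ha1 ha2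
  -- membership of the four configurations in the three states
  have mA0 : (∅ : BondConfig V) ∉ {η : BondConfig V | h₁ ∈ cl η.toFinset a ∧ h₂ ∈ cl η.toFinset a} := fun h => bE.1 h.1
  have mA1 : ({s(a, h₁)} : BondConfig V) ∉ {η : BondConfig V | h₁ ∈ cl η.toFinset a ∧ h₂ ∈ cl η.toFinset a} := fun h => bC.2.1 h.2
  have mA2 : ({s(a, h₂)} : BondConfig V) ∉ {η : BondConfig V | h₁ ∈ cl η.toFinset a ∧ h₂ ∈ cl η.toFinset a} := fun h => bD.1 h.1
  have mA3 : ({s(a, h₁), s(a, h₂)} : BondConfig V) ∈ {η : BondConfig V | h₁ ∈ cl η.toFinset a ∧ h₂ ∈ cl η.toFinset a} := ⟨bA.1, bA.2.1⟩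
  have mC0 : (∅ : BondConfig V) ∉ {η : BondConfig V | h₁ ∈ cl η.toFinset a ∧ h₂ ∉ cl η.toFinset a} := fun h => bE.1 h.1
  have mC1 : ({s(a, h₁)} : BondConfig V) ∈ {η : BondConfig V | h₁ ∈ cl η.toFinset a ∧ h₂ ∉ cl η.toFinset a} := ⟨bC.1, bC.2.1⟩
  have mC2 : ({s(a, h₂)} : BondConfig V) ∉ {η : BondConfig V | h₁ ∈ cl η.toFinset a ∧ h₂ ∉ cl η.toFinset a} := fun h => bD.1 h.1
  have mC3 : ({s(a, h₁), s(a, h₂)} : BondConfig V) ∉ {η : BondConfig V | h₁ ∈ cl η.toFinset a ∧ h₂ ∉ cl η.toFinset a} := fun h => h.2 bA.2.1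
  have mD0 : (∅ : BondConfig V) ∉ {η : BondConfig V | h₁ ∉ cl η.toFinset a ∧ h₂ ∈ cl η.toFinset a} := fun h => bE.2.1 h.2
  have mD1 : ({s(a, h₁)} : BondConfig V) ∉ {η : BondConfig V | h₁ ∉ cl η.toFinset a ∧ h₂ ∈ cl η.toFinset a} := fun h => h.1 bC.1
  have mD2 : ({s(a, h₂)} : BondConfig V) ∈ {η : BondConfig V | h₁ ∉ cl η.toFinset a ∧ h₂ ∈ cl η.toFinset a} := ⟨bD.1, bD.2.1⟩
  have mD3 : ({s(a, h₁), s(a, h₂)} : BondConfig V) ∉ {η : BondConfig V | h₁ ∉ cl η.toFinset a ∧ h₂ ∈ cl η.toFinset a} := fun h => h.1 bA.1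
  refine ⟨?_, ?_, ?_⟩
  · rw [gadget_sum h12 q u hu, ind_of_not_mem mA0, ind_of_not_mem mA1, ind_of_not_mem mA2, ind_of_mem mA3]
    unfold rcWeightW; rw [gadget_weight_pair h12 u hu]; ring
  · rw [gadget_sum h12 q u hu, ind_of_not_mem mC0, ind_of_mem mC1, ind_of_not_mem mC2, ind_of_not_mem mC3]
    unfold rcWeightW; rw [gadget_weight_one h12 u hu, k1]; ring
  · rw [gadget_sum h12 q u hu, ind_of_not_mem mD0, ind_of_not_mem mD1, ind_of_mem mD2, ind_of_not_mem mD3]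
    unfold rcWeightW; rw [gadget_weight_two h12 u hu, k2]; ring

end Gadget

/-! ### Folding the apex arm onto the gadget -/

section Fold

variable {DA DY D D' : Finset (Sym2 V)} {a h₁ h₂ b c : V} (h12 : h₁ ≠ h₂) (ha1 : a ≠ h₁) (ha2 : a ≠ h₂) (hab : a ≠ b) (hac : a ≠ c)
  (hsepD : ∀ z : V, (∃ e ∈ DA, z ∈ e) → (∃ e ∈ DY, z ∈ e) → (z = h₁ ∨ z = h₂)) (haY : ∀ e ∈ DY, a ∉ e)
  (hb : ∀ e ∈ DA, b ∈ e → (b = h₁ ∨ b = h₂)) (hc : ∀ e ∈ DA, c ∈ e → (c = h₁ ∨ c = h₂)) (hbc : c ∈ cl DY b)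
  (hD : ∀ e, e ∈ D ↔ e ∈ DA ∨ e ∈ DY) (hD' : ∀ e, e ∈ D' ↔ e ∈ ({s(a, h₁), s(a, h₂)} : Finset (Sym2 V)) ∨ e ∈ DY)
  (w w' wA u wY : Sym2 V → unitInterval) {q : ℝ} (hq : 0 < q)
  (hw : ∀ e, e ∉ (↑DA ∪ ↑DY : Set (Sym2 V)) → (w e : ℝ) = 0)
  (hX : ∀ e ∈ (↑DA : Set (Sym2 V)), wA e = w e) (hX' : ∀ e ∉ (↑DA : Set (Sym2 V)), wA e = 0)
  (hY : ∀ e ∈ (↑DA : Set (Sym2 V)), wY e = 0) (hY' : ∀ e ∉ (↑DA : Set (Sym2 V)), wY e = w e)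
  (gX : ∀ e ∈ (↑({s(a, h₁), s(a, h₂)} : Finset (Sym2 V)) : Set (Sym2 V)), u e = w' e)
  (gX' : ∀ e ∉ (↑({s(a, h₁), s(a, h₂)} : Finset (Sym2 V)) : Set (Sym2 V)), u e = 0)
  (gY' : ∀ e ∉ (↑({s(a, h₁), s(a, h₂)} : Finset (Sym2 V)) : Set (Sym2 V)), wY e = w' e)
include h12 ha1 ha2 hab hac hsepD haY hb hc hbc hD hD' hq hw hX hX' hY hY' gX gX' gY'

/-- **Apex-arm folding onto the gadget** (see the module docstring). [this work] -/
theorem r1_iff_gadget (hXA : (∑ η : BondConfig V, rcWeightW wA q ({h₁, h₂} : Set V) η * ind {η : BondConfig V | h₁ ∈ cl η.toFinset a ∧ h₂ ∈ cl η.toFinset a} η) ≠ 0)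
    (hp1 : (u s(a, h₁) : ℝ) * ((∑ η : BondConfig V, rcWeightW wA q ({h₁, h₂} : Set V) η * ind {η : BondConfig V | h₁ ∈ cl η.toFinset a ∧ h₂ ∈ cl η.toFinset a} η) + (∑ η : BondConfig V, rcWeightW wA q ({h₁, h₂} : Set V) η * ind {η : BondConfig V | h₁ ∉ cl η.toFinset a ∧ h₂ ∈ cl η.toFinset a} η)) = (∑ η : BondConfig V, rcWeightW wA q ({h₁, h₂} : Set V) η * ind {η : BondConfig V | h₁ ∈ cl η.toFinset a ∧ h₂ ∈ cl η.toFinset a} η)) (hp2 : (u s(a, h₂) : ℝ) * ((∑ η : BondConfig V, rcWeightW wA q ({h₁, h₂} : Set V) η * ind {η : BondConfig V | h₁ ∈ cl η.toFinset a ∧ h₂ ∈ cl η.toFinset a} η) + (∑ η : BondConfig V, rcWeightW wA q ({h₁, h₂} : Set V) η * ind {η : BondConfig V | h₁ ∈ cl η.toFinset a ∧ h₂ ∉ cl η.toFinset a} η)) = (∑ η : BondConfig V, rcWeightW wA q ({h₁, h₂} : Set V) η * ind {η : BondConfig V | h₁ ∈ cl η.toFinset a ∧ h₂ ∈ cl η.toFinset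 a} η)) :
    ((rcMeasureW w q ∅).real {η : BondConfig V | b ∈ cl η.toFinset a ∧ c ∈ cl η.toFinset a} * (rcMeasureW w q ∅).real {η : BondConfig V | b ∉ cl η.toFinset a ∧ c ∉ cl η.toFinset a ∧ Sep D (cl η.toFinset a) b c} ≤ (rcMeasureW w q ∅).real {η : BondConfig V | b ∈ cl η.toFinset a ∧ c ∉ cl η.toFinset a} * (rcMeasureW w q ∅).real {η : BondConfig V | b ∉ cl η.toFinset a ∧ c ∈ cl η.toFinset a}) ↔ ((rcMeasureW w' q ∅).real {η : BondConfig V | b ∈ cl η.toFinset a ∧ c ∈ cl η.toFinset a} * (rcMeasureW w' q ∅).real {η : BondConfig V | b ∉ cl η.toFinset a ∧ c ∉ cl η.toFinset a ∧ Sep D' (cl η.toFinset a) b c} ≤ (rcMeasureW w' q ∅).real {η : BondConfig V | b ∈ cl η.toFinset a ∧ c ∉ cl η.toFinset a} * (rcMeasureW w' q ∅).real {η : BondConfig V | b ∉ cl η.toFinset a ∧ c ∈ cl η.toFinset a}) := by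
  -- the gadget as an apex arm
  have hsepD' : ∀ z : V, (∃ e ∈ ({s(a, h₁), s(a, h₂)} : Finset (Sym2 V)), z ∈ e) → (∃ e ∈ DY, z ∈ e) → (z = h₁ ∨ z = h₂) := by
    rintro z ⟨e, he, hze⟩ ⟨f, hf, hzf⟩
    have hza : z ≠ a := fun h => haY f hf (h ▸ hzf)
    simp only [Finset.mem_insert, Finset.mem_singleton] at he
    rcases he with rfl | rfl
    · exact (Sym2.mem_iff.1 hze).elim (fun h => absurd h hza) Or.inl
    · exact (Sym2.mem_iff.1 hze).elim (fun h => absurd h hza) Or.inr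
  have hnot : ∀ x : V, x ≠ a → ∀ e ∈ ({s(a, h₁), s(a, h₂)} : Finset (Sym2 V)), x ∈ e → (x = h₁ ∨ x = h₂) := by
    intro x hxa e he hxe
    simp only [Finset.mem_insert, Finset.mem_singleton] at he
    rcases he with rfl | rfl
    · exact (Sym2.mem_iff.1 hxe).elim (fun h => absurd h hxa) Or.inl
    · exact (Sym2.mem_iff.1 hxe).elim (fun h => absurd h hxa) Or.inr
  have gY : ∀ e ∈ (↑({s(a, h₁), s(a, h₂)} : Finset (Sym2 V)) : Set (Sym2 V)), wY e = 0 := by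
    intro e he
    by_cases heA : e ∈ (↑DA : Set (Sym2 V))
    · exact hY e heA
    · have h1 : (wY e : ℝ) = 0 := by
        rw [hY' e heA]
        refine hw e (fun h => h.elim heA (fun heY => ?_))
        rw [Finset.coe_insert, Finset.coe_singleton] at he
        rcases he with rfl | rfl
        · exact haY _ heY (Sym2.mem_mk_left _ _)
        · exact haY _ heY (Sym2.mem_mk_left _ _)
      exact Subtype.ext h1
  have hw' : ∀ e, e ∉ (↑({s(a, h₁), s(a, h₂)} : Finset (Sym2 V)) ∪ ↑DY : Set (Sym2 V)) → (w' e : ℝ) = 0 := by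
    intro e he
    have he1 : e ∉ (↑({s(a, h₁), s(a, h₂)} : Finset (Sym2 V)) : Set (Sym2 V)) := fun h => he (Or.inl h)
    have he2 : e ∉ (↑DY : Set (Sym2 V)) := fun h => he (Or.inr h)
    rw [← gY' e he1]
    by_cases heA : e ∈ (↑DA : Set (Sym2 V))
    · rw [hY e heA]; rfl
    · rw [hY' e heA]; exact hw e (fun h => h.elim heA he2)
  have hu : ∀ e, e ≠ s(a, h₁) → e ≠ s(a, h₂) → u e = 0 := fun e h1 h2 =>
    gX' e (by rw [Finset.coe_insert, Finset.coe_singleton]; exact fun h => h.elim h1 h2)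
  obtain ⟨xAe, xCe, xDe⟩ := gadget_masses h12 ha1 ha2 q u hu
  have hp1' : (u s(a, h₁) : ℝ) ≠ 0 := fun h => hXA (by rw [h, zero_mul] at hp1; exact hp1.symm)
  have hp2' : (u s(a, h₂) : ℝ) ≠ 0 := fun h => hXA (by rw [h, zero_mul] at hp2; exact hp2.symm)
  have hκ : q ^ clusterCount ({s(a, h₁), s(a, h₂)} : BondConfig V) ({h₁, h₂} : Set V) ≠ 0 := (pow_pos hq _).ne'
  refine r1_iff_of_proportional h12 ha1 ha2 hab hac hsepD hsepD' haY hb hc (hnot b hab.symm) (hnot c hac.symm) hbc hD hD'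
    w w' wA u wY hq hw hw' hX hX' hY hY' gX gX' gY gY' hXA ?_ ?_ ?_
  · rw [xAe]; exact mul_ne_zero (mul_ne_zero hp1' hp2') hκ
  · rw [xCe, xAe]
    linear_combination (-((u s(a, h₁) : ℝ) * q ^ clusterCount ({s(a, h₁), s(a, h₂)} : BondConfig V) ({h₁, h₂} : Set V))) * hp2
  · rw [xDe, xAe]
    linear_combination (-((u s(a, h₂) : ℝ) * q ^ clusterCount ({s(a, h₁), s(a, h₂)} : BondConfig V) ({h₁, h₂} : Set V))) * hp1

end Fold

/-! ### The effective parameters exist -/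

section Exists

variable {a h₁ h₂ : V} (wA wY : Sym2 V → unitInterval) {q : ℝ} (hq : 0 < q)
include hq

/-- **Effective gadget parameters** `p₁ = (∑ η : BondConfig V, rcWeightW wA q ({h₁, h₂} : Set V) η * ind {η : BondConfig V | h₁ ∈ cl η.toFinset a ∧ h₂ ∈ cl η.toFinset a} η)/((∑ η : BondConfig V, rcWeightW wA q ({h₁, h₂} : Set V) η * ind {η : BondConfig V | h₁ ∈ cl η.toFinset a ∧ h₂ ∈ cl η.toFinset a} η)+(∑ η : BondConfig V, rcWeightW wA q ({h₁, h₂} : Set V) η * ind {η : BondConfig V | h₁ ∉ cl η.toFinset a ∧ h₂ ∈ cl η.toFinset a} η))`, `p₂ = (∑ η : BondConfig V, rcWeightW wA q ({h₁, h₂} : Set V) η * ind {η : BondConfig V | h₁ ∈ cl η.toFinset a ∧ h₂ ∈ cl η.toFinset a} η)/((∑ η : BondConfig V, rcWeightW wA q ({h₁, h₂} : Set V) η * ind {η : BondConfig V | h₁ ∈ cl η.toFinset a ∧ h₂ ∈ cl η.toFinset a} η)+(∑ η : BondConfig V, rcWeightW wA q ({h₁, h₂} : Set V) η * ind {η : BondConfig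 V | h₁ ∈ cl η.toFinset a ∧ h₂ ∉ cl η.toFinset a} η))`: a weight vector `u` on the gadget and `𝐩'` (= `u` on the gadget,
`= wY` off it) with `p₁((∑ η : BondConfig V, rcWeightW wA q ({h₁, h₂} : Set V) η * ind {η : BondConfig V | h₁ ∈ cl η.toFinset a ∧ h₂ ∈ cl η.toFinset a} η)+(∑ η : BondConfig V, rcWeightW wA q ({h₁, h₂} : Set V) η * ind {η : BondConfig V | h₁ ∉ cl η.toFinset a ∧ h₂ ∈ cl η.toFinset a} η)) = (∑ η : BondConfig V, rcWeightW wA q ({h₁, h₂} : Set V) η * ind {η : BondConfig V | h₁ ∈ cl η.toFinset a ∧ h₂ ∈ cl η.toFinset a} η)`, `p₂((∑ η : BondConfig V, rcWeightW wA q ({h₁, h₂} : Set V) η * ind {η : BondConfig V | h₁ ∈ cl η.toFinset a ∧ h₂ ∈ cl η.toFinset a} η)+(∑ η : BondConfig V, rcWeightW wA q ({h₁, h₂} : Set V) η * ind {η : BondConfig V | h₁ ∈ cl η.toFinset a ∧ h₂ ∉ cl η.toFinset a} η)) = (∑ η : BondConfig V, rcWeightW wA q ({h₁, h₂} : Set V)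 η * ind {η : BondConfig V | h₁ ∈ cl η.toFinset a ∧ h₂ ∈ cl η.toFinset a} η)`. [this work] -/
theorem exists_gadget_weight (h12 : h₁ ≠ h₂) (hXA : (∑ η : BondConfig V, rcWeightW wA q ({h₁, h₂} : Set V) η * ind {η : BondConfig V | h₁ ∈ cl η.toFinset a ∧ h₂ ∈ cl η.toFinset a} η) ≠ 0) :
    ∃ w' u : Sym2 V → unitInterval,
      (∀ e ∈ (↑({s(a, h₁), s(a, h₂)} : Finset (Sym2 V)) : Set (Sym2 V)), u e = w' e) ∧
      (∀ e ∉ (↑({s(a, h₁), s(a, h₂)} : Finset (Sym2 V)) : Set (Sym2 V)), u e = 0) ∧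
      (∀ e ∉ (↑({s(a, h₁), s(a, h₂)} : Finset (Sym2 V)) : Set (Sym2 V)), wY e = w' e) ∧
      (u s(a, h₁) : ℝ) * ((∑ η : BondConfig V, rcWeightW wA q ({h₁, h₂} : Set V) η * ind {η : BondConfig V | h₁ ∈ cl η.toFinset a ∧ h₂ ∈ cl η.toFinset a} η) + (∑ η : BondConfig V, rcWeightW wA q ({h₁, h₂} : Set V) η * ind {η : BondConfig V | h₁ ∉ cl η.toFinset a ∧ h₂ ∈ cl η.toFinset a} η)) = (∑ η : BondConfig V, rcWeightW wA q ({h₁, h₂} : Set V) η * ind {η : BondConfig V | h₁ ∈ cl η.toFinset a ∧ h₂ ∈ cl η.toFinset a} η) ∧ (u s(a, h₂) : ℝ) * ((∑ η : BondConfig V, rcWeightW wA q ({h₁, h₂} : Set V) η * ind {η : BondConfig V | h₁ ∈ cl η.toFinset a ∧ h₂ ∈ cl η.toFinset a} η) + (∑ η : BondConfig V, rcWeightW wA q ({h₁, h₂} : Set V) η * ind {η : BondConfig V | h₁ ∈ cl η.toFinset a ∧ h₂ ∉ cl η.toFinset a} η)) = (∑ η : BondConfig V, rcWeightW wA q ({h₁,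 h₂} : Set V) η * ind {η : BondConfig V | h₁ ∈ cl η.toFinset a ∧ h₂ ∈ cl η.toFinset a} η) := by
  have hne := gadget_ne (a := a) h12
  have nn : ∀ (E : Set (BondConfig V)), 0 ≤ ∑ η : BondConfig V, rcWeightW wA q ({h₁, h₂} : Set V) η * ind E η := fun E =>
    Finset.sum_nonneg fun η _ => mul_nonneg (rcWeightW_nonneg wA hq.le _ η) (ind_nonneg E η)
  have hA : 0 < (∑ η : BondConfig V, rcWeightW wA q ({h₁, h₂} : Set V) η * ind {η : BondConfig V | h₁ ∈ cl η.toFinset a ∧ h₂ ∈ cl η.toFinset a} η) := lt_of_le_of_ne (nn _) (Ne.symm hXA)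
  have hAD : 0 < (∑ η : BondConfig V, rcWeightW wA q ({h₁, h₂} : Set V) η * ind {η : BondConfig V | h₁ ∈ cl η.toFinset a ∧ h₂ ∈ cl η.toFinset a} η) + (∑ η : BondConfig V, rcWeightW wA q ({h₁, h₂} : Set V) η * ind {η : BondConfig V | h₁ ∉ cl η.toFinset a ∧ h₂ ∈ cl η.toFinset a} η) := add_pos_of_pos_of_nonneg hA (nn _)
  have hAC : 0 < (∑ η : BondConfig V, rcWeightW wA q ({h₁, h₂} : Set V) η * ind {η : BondConfig V | h₁ ∈ cl η.toFinset a ∧ h₂ ∈ cl η.toFinset a} η) + (∑ η : BondConfig V, rcWeightW wA q ({h₁, h₂} : Set V) η * ind {η : BondConfig V | h₁ ∈ cl η.toFinset a ∧ h₂ ∉ cl η.toFinset a} η) := add_pos_of_pos_of_nonneg hA (nn _)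
  have m1 : (∑ η : BondConfig V, rcWeightW wA q ({h₁, h₂} : Set V) η * ind {η : BondConfig V | h₁ ∈ cl η.toFinset a ∧ h₂ ∈ cl η.toFinset a} η) / ((∑ η : BondConfig V, rcWeightW wA q ({h₁, h₂} : Set V) η * ind {η : BondConfig V | h₁ ∈ cl η.toFinset a ∧ h₂ ∈ cl η.toFinset a} η) + (∑ η : BondConfig V, rcWeightW wA q ({h₁, h₂} : Set V) η * ind {η : BondConfig V | h₁ ∉ cl η.toFinset a ∧ h₂ ∈ cl η.toFinset a} η)) ∈ unitInterval := ⟨div_nonneg hA.le hAD.le, div_le_one_of_le₀ (by linarith [nn {η : BondConfig V | h₁ ∉ cl η.toFinset a ∧ h₂ ∈ cl η.toFinset a}]) hAD.le⟩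
  have m2 : (∑ η : BondConfig V, rcWeightW wA q ({h₁, h₂} : Set V) η * ind {η : BondConfig V | h₁ ∈ cl η.toFinset a ∧ h₂ ∈ cl η.toFinset a} η) / ((∑ η : BondConfig V, rcWeightW wA q ({h₁, h₂} : Set V) η * ind {η : BondConfig V | h₁ ∈ cl η.toFinset a ∧ h₂ ∈ cl η.toFinset a} η) + (∑ η : BondConfig V, rcWeightW wA q ({h₁, h₂} : Set V) η * ind {η : BondConfig V | h₁ ∈ cl η.toFinset a ∧ h₂ ∉ cl η.toFinset a} η)) ∈ unitInterval := ⟨div_nonneg hA.le hAC.le, div_le_one_of_le₀ (by linarith [nn {η : BondConfig V | h₁ ∈ cl η.toFinset a ∧ h₂ ∉ cl η.toFinset a}]) hAC.le⟩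
  set u : Sym2 V → unitInterval := fun e => if e = s(a, h₁) then ⟨_, m1⟩ else if e = s(a, h₂) then ⟨_, m2⟩ else 0 with hudef
  refine ⟨fun e => if e = s(a, h₁) ∨ e = s(a, h₂) then u e else wY e, u, ?_, ?_, ?_, ?_, ?_⟩
  · intro e he
    rw [Finset.coe_insert, Finset.coe_singleton] at he
    have he' : e = s(a, h₁) ∨ e = s(a, h₂) := he
    simp only [he', if_true]
  · intro e he
    rw [Finset.coe_insert, Finset.coe_singleton] at he
    have h1 : e ≠ s(a, h₁) := fun h => he (Or.inl h)
    have h2 : e ≠ s(a, h₂) := fun h => he (Or.inr h)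
    simp only [hudef, h1, h2, if_false]
  · intro e he
    rw [Finset.coe_insert, Finset.coe_singleton] at he
    have he' : ¬ (e = s(a, h₁) ∨ e = s(a, h₂)) := he
    simp only [he', if_false]
  · simp only [hudef, if_true]
    exact div_mul_cancel₀ _ hAD.ne'
  · simp only [hudef, hne.symm, if_false, if_true]
    exact div_mul_cancel₀ _ hAC.ne'

end Exists

end HubPairApex

end Summit.CriticalPhenomena.PercolationContinuityZ3.Theorems
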